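import Summits.Ventures.HSemireg.WedgeHankelSubstitutionClassSpace
import Summits.Ventures.HSemireg.WedgeHankelSubstitutionParabolic
import Summits.Ventures.HSemireg.WedgeHankelPairMixingDet

/-!
# Venture HSemireg — THE CLASS SPACE UNDER THE MONOID `M₂(K) × M_n(K)`: a pair mixing acts on the classes by the SCALAR `det M` (`det = (det M)^{n+1}`), it commutes with every substitution,
# and a SINGULAR substitution (`α ≠ 0`, `αδ = βγ`) has RANK ONE on the class space — image the line of the pure class of its image letter `x + (β/α)y`, kernel the hyperplane
# `Σ_s C(n,s) α^{n−s} γ^s q_s = 0` of dimension `n`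

HONEST FRAMING. Part of the Lean index of the computation cell `pub-hsemireg` (seat p10 gen 19, Sunday typer «UNIFORM-IN-n»).
Finite-dimensional EXTERIOR ALGEBRA + linear algebra ONLY: no variety, no cohomology theory, no sheaf, no Ext group, no semiregularity map;
nothing here says that HC / HC_CM / HC_AV holds; no Literature fact is declared or used.  Custodian versions as in `WedgeHankelSiegelIdeal` (1/3) and `WedgeHankelFrameChange`;
the dictionary (the class space = `Sym^n` of the letters' plane, a `det`-line for the pair mixings; a singular change of frame = a degeneration of the complex structure) is QUOTED, never asserted.

WHAT IS IN THE TREE.  I11 `WedgeHankelSubstitutionClassSpace` (962): `spikeSpan n` (= `coSiegel_n`), `spikeBasis`, `SbC g` (the restriction of `Sb g`), `toMatrix_SbC = S_n(g)`, `det_SbC`; H9b (924):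
`Pm_w_eq_det_smul` (`Pm M (w_n q) = det M · w_n q`), `Pm_Sb` (the two actions commute); H5 (926): `Sb_w_of_det_eq_zero` (a singular substitution with `α ≠ 0` sends `w_n(q)` to
`c(q)·w_n((β/α)^•)`, `c(q) = expMul α (scaleSeq γ q) n`); H12 (936): `rank S_c(g) ≤ 1` for singular `g`; I8 (952): `exists_eq_w_of_mem_coSiegel`, `Φs_w_spike_zero`.  THIS FILE (namespace
`Summit.Ventures.HSemireg.Wedge.HankelFrameChange` continued):
* §195 `finrank_spikeSpan` (`= n + 1`), `Pm_mem_spikeSpan`, **`PmC M`** (the restriction of `Pm M` to the class space), **`PmC_eq_smul_id`: `PmC M = det M • id`**, **`det_PmC`: `det (Pm M | classes) =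
  (det M)^{n+1}`**, `PmC_comp_SbC` (the two restricted actions commute).
* §196 A SINGULAR SUBSTITUTION ON THE CLASS SPACE (`α ≠ 0`, `αδ = βγ`): `pure_mem_spikeSpan`, `pure_ne_zero`, **`SbC_apply_of_det_eq_zero`** (`SbC g (w_n q) = c(q) · w_n((β/α)^•)`),
  **`range_SbC_of_det_eq_zero`: the image is the LINE `K ∙ w_n((β/α)^•)`** (the value `c(δ_0) = α^n ≠ 0` is attained), **`finrank_range_SbC_of_det_eq_zero = 1`** and
  **`finrank_ker_SbC_of_det_eq_zero = n`** (rank–nullity) — the class-space form of H12's «rank `S_c(g) ≤ 1`», with EQUALITY; `SbC_w_eq_zero_iff` (the kernel is the hyperplane `c(q) = 0`).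
NOT typed here: the cases `α = 0` (then `βγ = 0`: `x ↦ 0` or the `y`-frame collapse, H5 `Sb_w_of_alpha_beta_zero` / `Sb_w_of_alpha_gamma_zero`); the image of a singular `Pm M` on the
class space (it is `0`: `Pm_w_eq_zero_of_det_eq_zero`, H9b); anything Ext-side.  New names only.
-/

open Module

namespace Summit.Ventures.HSemireg.Wedge.HankelFrameChange

open Summit.Ventures.HSemireg.Wedge Summit.Ventures.HSemireg.Wedge.Kunneth Summit.Ventures.HSemireg.Wedge.Hankel
  Summit.Ventures.HSemireg.Wedge.BasisFree Summit.Ventures.HSemireg.Wedge.HankelSiegel Summit.Ventures.HSemireg.Wedge.HankelSiegelIdeal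
  Summit.Ventures.HSemireg.Wedge.KunnethKernel Summit.Ventures.HSemireg.Wedge.HankelRankOne Summit.Ventures.HSemireg.Wedge.KernelDuality
  Summit.Ventures.HSemireg.Wedge.HankelPairMixing

variable (K : Type*) [Field K] {n : ℕ}

/-! ## §195. Pair mixings act on the class space by the scalar `det M` -/

/-- `dim spikeSpan n = n + 1` (th-7's spike basis). -/
theorem finrank_spikeSpan : finrank K (spikeSpan K n) = n + 1 := by
  rw [finrank_eq_card_basis (spikeBasis K n), Fintype.card_fin]

/-- **every pair mixing maps the class space into itself** (`Pm M (w_n q) = det M · w_n q`). -/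
theorem Pm_mem_spikeSpan (M : Matrix (Fin n) (Fin n) K) {f : HT K (In n)} (hf : f ∈ spikeSpan K n) : Pm K M f ∈ spikeSpan K n := by
  rw [spikeSpan_eq_coSiegel] at hf ⊢
  obtain ⟨q, rfl⟩ := exists_eq_w_of_mem_coSiegel K hf
  rw [Pm_w_eq_det_smul]
  exact Submodule.smul_mem _ _ (w_mem_coSiegel K q)

/-- **THE PAIR MIXING RESTRICTED TO THE CLASS SPACE.** -/
noncomputable def PmC (M : Matrix (Fin n) (Fin n) K) : spikeSpan K n →ₗ[K] spikeSpan K n :=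
  (Pm K (n := n) M).toLinearMap.restrict fun _ hf => Pm_mem_spikeSpan K M hf

/-- `PmC` is `Pm` on the underlying forms. -/
@[simp] lemma PmC_apply_coe (M : Matrix (Fin n) (Fin n) K) (f : spikeSpan K n) : (PmC K M f : HT K (In n)) = Pm K M (f : HT K (In n)) := rfl

/-- **`PmC M = det M • id`: a pair mixing acts on the classes by the SCALAR `det M`** (H9b). -/
theorem PmC_eq_smul_id (M : Matrix (Fin n) (Fin n) K) : PmC K M = M.det • (LinearMap.id : spikeSpan K n →ₗ[K] spikeSpan K n) := by
  refine LinearMap.ext fun f => Subtype.ext ?_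
  have hf : (f : HT K (In n)) ∈ coSiegel K n n := by rw [← spikeSpan_eq_coSiegel]; exact f.2
  obtain ⟨q, hq⟩ := exists_eq_w_of_mem_coSiegel K hf
  rw [PmC_apply_coe, LinearMap.smul_apply, LinearMap.id_apply, Submodule.coe_smul, hq, Pm_w_eq_det_smul]

/-- **`det (Pm M | classes) = (det M)^{n+1}`.** -/
theorem det_PmC (M : Matrix (Fin n) (Fin n) K) : LinearMap.det (PmC K M) = M.det ^ (n + 1) := by
  rw [PmC_eq_smul_id, LinearMap.det_smul, LinearMap.det_id, mul_one, finrank_spikeSpan]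

/-- for `det M = 0` the pair mixing KILLS the class space. -/
theorem PmC_eq_zero_of_det_eq_zero {M : Matrix (Fin n) (Fin n) K} (hM : M.det = 0) : PmC K M = 0 := by
  rw [PmC_eq_smul_id, hM, zero_smul]

/-- **the two restricted actions commute: `PmC M ∘ SbC g = SbC g ∘ PmC M`** (H9b `Pm_Sb`). -/
theorem PmC_comp_SbC (M : Matrix (Fin n) (Fin n) K) (α β γ δ : K) : (PmC K M).comp (SbC K α β γ δ) = (SbC K α β γ δ).comp (PmC K M) := by
  refine LinearMap.ext fun f => Subtype.ext ?_
  simp only [LinearMap.comp_apply, PmC_apply_coe, SbC_apply_coe, Pm_Sb]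

/-! ## §196. A singular substitution has rank one on the class space -/

/-- the pure class of a node lies in the class space. -/
lemma pure_mem_spikeSpan (lam : K) : w K n n (fun j => lam ^ j) ∈ spikeSpan K n := w_mem_spikeSpan K _

/-- the pure class of a node is non-zero (`= Φs λ (E_0)`, `E_0 ≠ 0`). -/
theorem pure_ne_zero (lam : K) : w K n n (fun j => lam ^ j) ≠ 0 := by
  rw [← Φs_w_spike_zero K lam]
  exact fun h => w_spike_ne_zero K (Nat.zero_le n) ((Φs K lam).injective (by rw [h, map_zero]))

/-- **a SINGULAR substitution (`α ≠ 0`, `αδ = βγ`) on the class space: `SbC g (w_n q) = c(q) · w_n((β/α)^•)`**, `c(q) = expMul α (scaleSeq γ q) n` (H5). -/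
theorem SbC_apply_of_det_eq_zero {α : K} (hα : α ≠ 0) {β γ δ : K} (hdet : α * δ - β * γ = 0) (q : ℕ → K) :
    SbC K α β γ δ ⟨w K n n q, w_mem_spikeSpan K q⟩ = expMul K α (scaleSeq K γ q) n • (⟨w K n n (fun j => (β / α) ^ j), pure_mem_spikeSpan K (β / α)⟩ : spikeSpan K n) := by
  apply Subtype.ext
  rw [SbC_apply_coe, Submodule.coe_smul, Sb_w_of_det_eq_zero K hα hdet, w_exp_eq_smul_vol]

/-- **`SbC g (w_n q) = 0` IFF `c(q) = 0`**: the kernel on the class space is the hyperplane `Σ_s C(n,s) α^{n−s} γ^s q_s = 0`. -/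
theorem SbC_w_eq_zero_iff {α : K} (hα : α ≠ 0) {β γ δ : K} (hdet : α * δ - β * γ = 0) (q : ℕ → K) :
    SbC K α β γ δ ⟨w K n n q, w_mem_spikeSpan K q⟩ = 0 ↔ expMul K α (scaleSeq K γ q) n = 0 := by
  rw [SbC_apply_of_det_eq_zero K hα hdet, smul_eq_zero]
  refine ⟨fun h => h.resolve_right fun h0 => pure_ne_zero K (β / α) (congrArg Subtype.val h0), fun h => Or.inl h⟩

/-- **THE IMAGE OF THE CLASS SPACE UNDER A SINGULAR SUBSTITUTION IS THE LINE OF THE PURE CLASS OF ITS IMAGE LETTER: `range (SbC g) = K ∙ w_n((β/α)^•)`** (`α ≠ 0`, `αδ = βγ`; the value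
`c(δ_0) = α^n ≠ 0` is attained). -/
theorem range_SbC_of_det_eq_zero {α : K} (hα : α ≠ 0) {β γ δ : K} (hdet : α * δ - β * γ = 0) :
    LinearMap.range (SbC K α β γ δ (n := n)) = K ∙ (⟨w K n n (fun j => (β / α) ^ j), pure_mem_spikeSpan K (β / α)⟩ : spikeSpan K n) := by
  apply le_antisymm
  · rintro _ ⟨f, rfl⟩
    have hf : (f : HT K (In n)) ∈ coSiegel K n n := by rw [← spikeSpan_eq_coSiegel]; exact f.2
    obtain ⟨q, hq⟩ := exists_eq_w_of_mem_coSiegel K hf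
    have ef : f = ⟨w K n n q, w_mem_spikeSpan K q⟩ := Subtype.ext hq
    rw [ef, SbC_apply_of_det_eq_zero K hα hdet]
    exact Submodule.smul_mem _ _ (Submodule.mem_span_singleton_self _)
  · rw [Submodule.span_singleton_le_iff_mem, LinearMap.mem_range]
    -- the class `E_0 = w_n(δ_0)` has value `c(δ_0) = α^n`
    refine ⟨(α ^ n)⁻¹ • ⟨w K n n (fun j => if j = 0 then (1 : K) else 0), w_mem_spikeSpan K _⟩, ?_⟩
    rw [map_smul, SbC_apply_of_det_eq_zero K hα hdet, smul_smul]
    have hc : expMul K α (scaleSeq K γ fun j => if j = 0 then (1 : K) else 0) n = α ^ n := by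
      have hs : scaleSeq K γ (fun j => if j = 0 then (1 : K) else 0) = fun j => if j = 0 then (1 : K) else 0 := by
        funext j
        by_cases hj : j = 0
        · subst hj; simp [scaleSeq]
        · simp [scaleSeq, hj]
      rw [hs, expMul_spike_zero, one_mul]
    rw [hc, inv_mul_cancel₀ (pow_ne_zero n hα), one_smul]

/-- **`rank (Sb g | classes) = 1` for a singular `g` with `α ≠ 0`** (H12 had `≤ 1` for the matrix; here equality on the class space). -/
theorem finrank_range_SbC_of_det_eq_zero {α : K} (hα : α ≠ 0) {β γ δ : K} (hdet : α * δ - β * γ = 0) : finrank K (LinearMap.range (SbC K α β γ δ (n := n))) = 1 := by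
  rw [range_SbC_of_det_eq_zero K hα hdet, finrank_span_singleton]
  exact fun h => pure_ne_zero K (β / α) (congrArg Subtype.val h)

/-- **… and `dim ker (Sb g | classes) = n`** (rank–nullity on the `(n+1)`-dimensional class space): the classes whose evaluation at the kernel letter vanishes. -/
theorem finrank_ker_SbC_of_det_eq_zero {α : K} (hα : α ≠ 0) {β γ δ : K} (hdet : α * δ - β * γ = 0) : finrank K (LinearMap.ker (SbC K α β γ δ (n := n))) = n := by
  have h := LinearMap.finrank_range_add_finrank_ker (SbC K α β γ δ (n := n))
  rw [finrank_range_SbC_of_det_eq_zero K hα hdet, finrank_spikeSpan] at h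
  omega

end Summit.Ventures.HSemireg.Wedge.HankelFrameChange
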